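import Mathlib

/-!
# Hidden Toeplitz corners, lemma R: left-inverse kit

Auxiliary linear algebra for the line `Sketch` of `HiddenCornerLemmaR`:

* `hclR_rank_fromCols_eq_add`: if `Λ * F = 1` then
  `rank [F | M] = r + rank ((1 - F * Λ) * M)` (column-split rank identity);
* `hclR_exists_leftInv_nilpotent_shift`: a full-column-rank `F` admits a left inverse `Λ`
  such that the compression `Λ * Z * F` of the lower shift `Z` is nilpotent;
* `hclR_exists_leftInv_nilpotent_shiftT`: the same for the upper shift `Zᵀ`.

Proof sketch.  For the rank identity, the column space of `[F | M]` is
`im F ⊔ im M = im F ⊔ im K` with `K := (1 - F Λ) M = M - F (Λ M)`, and `im F ⊓ im K = 0`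
because the idempotent `P := F Λ` fixes `im F` and kills `im K`; the dimension formula for
`⊔`/`⊓` and `rank F = r` (from `Λ F = 1`) conclude.

For the adapted left inverse we argue abstractly: if `S` is a nilpotent endomorphism of a
vector space `U` and `V ≤ U` (here `V = im F`), the image flag `G k := im (S ^ k)` is
`S`-compressed (`S (G k) ≤ G (k+1)`), and one constructs inductively a complement `W` of `V`
with `G k ≤ (V ⊓ G k) ⊔ W` for every `k`.  For the projection `π` onto `V` along `W` the map
`π ∘ S` then sends `V ⊓ G k` into `V ⊓ G (k+1)`, hence `π ∘ S` restricted to `V` is nilpotent.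
Transporting through the isomorphism `F : ℂ^r ≃ V` gives `Λ := F⁻¹ ∘ π` with `Λ F = 1` and
`Λ S F` nilpotent.  The lower shift `Z` and its transpose are nilpotent, which gives both
existence statements.
-/

set_option linter.dupNamespace false

namespace Summit.MatrixMultiplication.MatrixMultiplication.Theorems

open scoped Matrix

/-! ### The column-split rank identity -/

/-- The column space of a column-partitioned matrix is the sup of the two column spaces. -/
private theorem hclR_range_mulVecLin_fromCols {N r m : ℕ} (A : Matrix (Fin N) (Fin r) ℂ)
    (B : Matrix (Fin N) (Fin m) ℂ) :
    LinearMap.range (Matrix.fromCols A B).mulVecLin =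
      LinearMap.range A.mulVecLin ⊔ LinearMap.range B.mulVecLin := by
  apply le_antisymm
  · rintro x ⟨v, rfl⟩
    rw [Matrix.mulVecLin_apply, Matrix.fromCols_mulVec]
    exact Submodule.add_mem_sup (LinearMap.mem_range_self A.mulVecLin _)
      (LinearMap.mem_range_self B.mulVecLin _)
  · refine sup_le ?_ ?_
    · rintro x ⟨v, rfl⟩
      refine ⟨Sum.elim v 0, ?_⟩
      rw [Matrix.mulVecLin_apply, Matrix.mulVecLin_apply, Matrix.fromCols_mulVec_sumElim,
        Matrix.mulVec_zero, add_zero]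
    · rintro x ⟨v, rfl⟩
      refine ⟨Sum.elim 0 v, ?_⟩
      rw [Matrix.mulVecLin_apply, Matrix.mulVecLin_apply, Matrix.fromCols_mulVec_sumElim,
        Matrix.mulVec_zero, zero_add]

/-- Column-split rank identity: if `Λ` is a left inverse of `F` then
`rank [F | M] = r + rank ((1 − F Λ) M)`. -/
theorem hclR_rank_fromCols_eq_add {N r m : ℕ} (F : Matrix (Fin N) (Fin r) ℂ)
    (Λ : Matrix (Fin r) (Fin N) ℂ) (hΛ : Λ * F = 1) (M : Matrix (Fin N) (Fin m) ℂ) :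
    (Matrix.fromCols F M).rank = r + ((1 - F * Λ) * M).rank := by
  set K : Matrix (Fin N) (Fin m) ℂ := (1 - F * Λ) * M with hK
  -- `rank F = r`
  have hFr : F.rank = r := by
    apply le_antisymm (Matrix.rank_le_width F)
    have h := Matrix.rank_mul_le_right Λ F
    rwa [hΛ, Matrix.rank_one, Fintype.card_fin] at h
  have hKM : K = M - F * (Λ * M) := by
    rw [hK, Matrix.sub_mul, Matrix.one_mul, Matrix.mul_assoc]
  -- `im F ⊔ im M = im F ⊔ im K`
  have hsup : LinearMap.range F.mulVecLin ⊔ LinearMap.range M.mulVecLin =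
      LinearMap.range F.mulVecLin ⊔ LinearMap.range K.mulVecLin := by
    apply le_antisymm
    · refine sup_le le_sup_left ?_
      rintro x ⟨w, rfl⟩
      have : M *ᵥ w = F *ᵥ ((Λ * M) *ᵥ w) + K *ᵥ w := by
        rw [Matrix.mulVec_mulVec, hKM, Matrix.sub_mulVec]; abel
      rw [Matrix.mulVecLin_apply, this]
      exact Submodule.add_mem_sup (LinearMap.mem_range_self F.mulVecLin _)
        (LinearMap.mem_range_self K.mulVecLin _)
    · refine sup_le le_sup_left ?_
      rintro x ⟨w, rfl⟩
      have : K *ᵥ w = F *ᵥ (-((Λ * M) *ᵥ w)) + M *ᵥ w := by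
        rw [Matrix.mulVec_neg, Matrix.mulVec_mulVec, hKM, Matrix.sub_mulVec]; abel
      rw [Matrix.mulVecLin_apply, this]
      exact Submodule.add_mem_sup (LinearMap.mem_range_self F.mulVecLin _)
        (LinearMap.mem_range_self M.mulVecLin _)
  -- `im F ⊓ im K = 0`
  have hdisj : LinearMap.range F.mulVecLin ⊓ LinearMap.range K.mulVecLin = ⊥ := by
    rw [← disjoint_iff, Submodule.disjoint_def]
    rintro x ⟨v, rfl⟩ ⟨w, hw⟩
    simp only [Matrix.mulVecLin_apply] at hw ⊢
    have h1 : (F * Λ) *ᵥ (F *ᵥ v) = F *ᵥ v := by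
      rw [Matrix.mulVec_mulVec, Matrix.mul_assoc, hΛ, Matrix.mul_one]
    have h2 : (F * Λ) *ᵥ (K *ᵥ w) = 0 := by
      rw [Matrix.mulVec_mulVec, hK, ← Matrix.mul_assoc, Matrix.mul_sub, Matrix.mul_one,
        Matrix.mul_assoc F Λ (F * Λ), ← Matrix.mul_assoc Λ F Λ, hΛ, Matrix.one_mul, sub_self,
        Matrix.zero_mul, Matrix.zero_mulVec]
    rw [← h1, ← hw, h2]
  have hfin := Submodule.finrank_sup_add_finrank_inf_eq (LinearMap.range F.mulVecLin)
    (LinearMap.range K.mulVecLin)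
  rw [hdisj, finrank_bot, add_zero] at hfin
  unfold Matrix.rank
  rw [hclR_range_mulVecLin_fromCols, hsup, hfin]
  congr 1

/-! ### Adapted complements and projections -/

/-- One step of the adapted-complement construction: a subspace `W ≤ B` disjoint from `V` can
be enlarged inside `B` to a subspace `W'`, still disjoint from `V`, with `B = (V ⊓ B) + W'`. -/
private theorem hclR_adapted_step {U : Type*} [AddCommGroup U] [Module ℂ U]
    (V W B : Submodule ℂ U) (hVW : Disjoint V W) (hWB : W ≤ B) :
    ∃ W' : Submodule ℂ U, W ≤ W' ∧ W' ≤ B ∧ Disjoint V W' ∧ B ≤ (V ⊓ B) ⊔ W' := by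
  obtain ⟨C, hC⟩ := Submodule.exists_isCompl ((V ⊓ B) ⊔ W)
  have hAB : (V ⊓ B) ⊔ W ≤ B := sup_le inf_le_right hWB
  refine ⟨W ⊔ C ⊓ B, le_sup_left, sup_le hWB inf_le_right, ?_, ?_⟩
  · rw [Submodule.disjoint_def]
    intro x hxV hxW
    obtain ⟨w, hw, c, hc, rfl⟩ := Submodule.mem_sup.mp hxW
    obtain ⟨hcC, hcB⟩ := Submodule.mem_inf.mp hc
    have hxB : w + c ∈ B := B.add_mem (hWB hw) hcB
    have hxA : w + c ∈ (V ⊓ B) ⊔ W := Submodule.mem_sup_left (Submodule.mem_inf.mpr ⟨hxV, hxB⟩)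
    have hcA : c ∈ (V ⊓ B) ⊔ W := by
      have := Submodule.sub_mem _ hxA (Submodule.mem_sup_right hw : w ∈ (V ⊓ B) ⊔ W)
      rwa [add_sub_cancel_left] at this
    have hc0 : c = 0 := (Submodule.disjoint_def.mp hC.disjoint) c hcA hcC
    rw [hc0, add_zero] at hxV ⊢
    exact (Submodule.disjoint_def.mp hVW) w hxV hw
  · intro x hxB
    have hx : x ∈ (V ⊓ B) ⊔ W ⊔ C := by rw [hC.sup_eq_top]; exact Submodule.mem_top
    obtain ⟨a, ha, c, hcC, rfl⟩ := Submodule.mem_sup.mp hx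
    have haB : a ∈ B := hAB ha
    have hcB : c ∈ B := by
      have := Submodule.sub_mem _ hxB haB
      rwa [add_sub_cancel_left] at this
    have hle : (V ⊓ B) ⊔ W ≤ (V ⊓ B) ⊔ (W ⊔ C ⊓ B) := sup_le_sup_left le_sup_left _
    refine Submodule.add_mem _ (hle ha) ?_
    exact Submodule.mem_sup_right (Submodule.mem_sup_right (Submodule.mem_inf.mpr ⟨hcC, hcB⟩))

/-- Adapted complement for a monotone family: there is `W` disjoint from `V`, inside `G n`,
with `G j = (V ⊓ G j) + W` modulo `W` for all `j ≤ n`. -/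
private theorem hclR_adapted_mono {U : Type*} [AddCommGroup U] [Module ℂ U]
    (V : Submodule ℂ U) (G : ℕ → Submodule ℂ U) (hG : Monotone G) (n : ℕ) :
    ∃ W : Submodule ℂ U, Disjoint V W ∧ W ≤ G n ∧ ∀ j ≤ n, G j ≤ (V ⊓ G j) ⊔ W := by
  induction n with
  | zero =>
    obtain ⟨W', -, hW'B, hVW', hB⟩ := hclR_adapted_step V ⊥ (G 0) disjoint_bot_right bot_le
    refine ⟨W', hVW', hW'B, fun j hj => ?_⟩
    obtain rfl := Nat.le_zero.mp hj
    exact hB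
  | succ n ih =>
    obtain ⟨W, hVW, hWG, hW⟩ := ih
    obtain ⟨W', hWW', hW'B, hVW', hB⟩ :=
      hclR_adapted_step V W (G (n + 1)) hVW (hWG.trans (hG n.le_succ))
    refine ⟨W', hVW', hW'B, fun j hj => ?_⟩
    rcases Nat.lt_or_ge j (n + 1) with hjn | hjn
    · exact (hW j (Nat.lt_succ_iff.mp hjn)).trans (sup_le_sup_left hWW' _)
    · obtain rfl := le_antisymm hj hjn
      exact hB

/-- Adapted complement for an antitone family (flag): there is `W` disjoint from `V` with
`G k ≤ (V ⊓ G k) ⊔ W` for all `k ≤ n`. -/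
private theorem hclR_adapted_anti {U : Type*} [AddCommGroup U] [Module ℂ U]
    (V : Submodule ℂ U) (G : ℕ → Submodule ℂ U) (hG : Antitone G) (n : ℕ) :
    ∃ W : Submodule ℂ U, Disjoint V W ∧ ∀ k ≤ n, G k ≤ (V ⊓ G k) ⊔ W := by
  obtain ⟨W, hVW, -, hW⟩ := hclR_adapted_mono V (fun j => G (n - j))
    (fun a b hab => hG (Nat.sub_le_sub_left hab n)) n
  refine ⟨W, hVW, fun k hk => ?_⟩
  have := hW (n - k) (Nat.sub_le n k)
  simpa only [Nat.sub_sub_self hk] using this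

/-- Abstract adapted projection: for an injection `i : P → U` and an endomorphism `S` of `U`
with `S ^ n = 0` there is a complement `W` of `im i` such that the compression
`π ∘ S ∘ i` (with `π` the projection onto `P` along `W`) is nilpotent. -/
private theorem hclR_exists_isCompl_isNilpotent {U P : Type*} [AddCommGroup U] [Module ℂ U]
    [AddCommGroup P] [Module ℂ P] (i : P →ₗ[ℂ] U) (hi : Function.Injective i)
    (S : U →ₗ[ℂ] U) {n : ℕ} (hS : S ^ n = 0) :
    ∃ W : Submodule ℂ U, ∃ h : IsCompl (LinearMap.range i) W,
      IsNilpotent (LinearMap.linearProjOfIsCompl W i hi h ∘ₗ S ∘ₗ i) := by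
  have hanti : Antitone fun k => LinearMap.range (S ^ k) := by
    refine antitone_nat_of_succ_le fun k => ?_
    rintro x ⟨y, hy⟩
    exact ⟨S y, by rw [← hy, pow_succ, Module.End.mul_apply]⟩
  obtain ⟨W, hVW, hW⟩ := hclR_adapted_anti (LinearMap.range i) (fun k => LinearMap.range (S ^ k))
    hanti n
  have hcod : Codisjoint (LinearMap.range i) W := by
    rw [codisjoint_iff, eq_top_iff]
    have h0 := hW 0 (Nat.zero_le _)
    simp only [pow_zero, Module.End.one_eq_id, LinearMap.range_id] at h0
    exact h0.trans (sup_le_sup_right inf_le_left _)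
  have h : IsCompl (LinearMap.range i) W := ⟨hVW, hcod⟩
  refine ⟨W, h, n, ?_⟩
  set ψ := LinearMap.linearProjOfIsCompl W i hi h ∘ₗ S ∘ₗ i with hψ
  have key : ∀ k ≤ n, ∀ x, i ((ψ ^ k) x) ∈ LinearMap.range (S ^ k) := by
    intro k
    induction k with
    | zero =>
      intro _ x
      simp only [pow_zero, Module.End.one_eq_id, LinearMap.range_id]
      exact Submodule.mem_top
    | succ k ih =>
      intro hk x
      have hx := ih (Nat.le_of_succ_le hk) x
      have hSx : S (i ((ψ ^ k) x)) ∈ LinearMap.range (S ^ (k + 1)) := by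
        obtain ⟨y, hy⟩ := hx
        exact ⟨y, by rw [pow_succ', Module.End.mul_apply, hy]⟩
      obtain ⟨a, ha, b, hb, hab⟩ := Submodule.mem_sup.mp (hW (k + 1) hk hSx)
      obtain ⟨haV, haG⟩ := Submodule.mem_inf.mp ha
      obtain ⟨z, rfl⟩ := haV
      have hz : (ψ ^ (k + 1)) x = z := by
        rw [pow_succ', Module.End.mul_apply, hψ, LinearMap.comp_apply, LinearMap.comp_apply,
          ← hab, map_add, LinearMap.linearProjOfIsCompl_apply_left,
          LinearMap.linearProjOfIsCompl_apply_right' _ _ _ _ _ hb, add_zero]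
      rw [hz]
      exact haG
  refine LinearMap.ext fun x => ?_
  have hx := key n le_rfl x
  rw [hS, LinearMap.range_zero, Submodule.mem_bot, map_eq_zero_iff i hi] at hx
  rw [hx, LinearMap.zero_apply]

/-! ### Matrix form -/

/-- Matrix form of the adapted projection: a full-column-rank `F` has a left inverse `Λ` with
`Λ * S * F` nilpotent, for any nilpotent `S`. -/
private theorem hclR_exists_leftInv_nilpotent_of_isNilpotent {N r : ℕ}
    (S : Matrix (Fin N) (Fin N) ℂ) (hS : IsNilpotent S) (F : Matrix (Fin N) (Fin r) ℂ)
    (hF : F.rank = r) :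
    ∃ Λ : Matrix (Fin r) (Fin N) ℂ, Λ * F = 1 ∧ IsNilpotent (Λ * S * F) := by
  have hi : Function.Injective (Matrix.toLin' F) := by
    rw [← LinearMap.ker_eq_bot, ← Submodule.finrank_eq_zero]
    have h1 := LinearMap.finrank_range_add_finrank_ker (Matrix.toLin' F)
    rw [Module.finrank_fin_fun] at h1
    have h2 : Module.finrank ℂ (LinearMap.range (Matrix.toLin' F)) = r := hF
    omega
  obtain ⟨n, hn⟩ := hS
  have hSn : Matrix.toLin' S ^ n = 0 := by rw [← Matrix.toLin'_pow, hn, map_zero]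
  obtain ⟨W, h, hnil⟩ := hclR_exists_isCompl_isNilpotent (Matrix.toLin' F) hi (Matrix.toLin' S) hSn
  refine ⟨LinearMap.toMatrix' (LinearMap.linearProjOfIsCompl W _ hi h), ?_, ?_⟩
  · apply Matrix.toLin'.injective
    rw [Matrix.toLin'_mul, Matrix.toLin'_toMatrix', Matrix.toLin'_one]
    exact LinearMap.ext fun x => LinearMap.linearProjOfIsCompl_apply_left _ _ hi h x
  · rw [← Matrix.isNilpotent_toLin'_iff, Matrix.toLin'_mul, Matrix.toLin'_mul,
      Matrix.toLin'_toMatrix']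
    exact hnil

/-- The lower shift matrix is nilpotent. -/
private theorem hclR_isNilpotent_shift (N : ℕ) :
    IsNilpotent (Matrix.of fun i j : Fin N => if (i : ℕ) = (j : ℕ) + 1 then (1 : ℂ) else 0) := by
  set Z : Matrix (Fin N) (Fin N) ℂ :=
    Matrix.of fun i j : Fin N => if (i : ℕ) = (j : ℕ) + 1 then (1 : ℂ) else 0 with hZ
  have key : ∀ (k : ℕ) (x : Fin N → ℂ) (i : Fin N), (i : ℕ) < k → (Z ^ k *ᵥ x) i = 0 := by
    intro k
    induction k with
    | zero => intro x i hi; exact absurd hi (Nat.not_lt_zero _)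
    | succ k ih =>
      intro x i hi
      rw [pow_succ', ← Matrix.mulVec_mulVec, Matrix.mulVec, dotProduct]
      refine Finset.sum_eq_zero fun j _ => ?_
      rw [hZ, Matrix.of_apply]
      split_ifs with hij
      · rw [ih x j (by omega), mul_zero]
      · rw [zero_mul]
  rw [Matrix.isNilpotent_iff]
  exact fun v => ⟨N, funext fun i => key N v i i.isLt⟩

/-- Adapted left inverse, lower-shift side: a full-column-rank `F` has a left inverse `Λ` for which
the compression `Λ Z F` of the lower shift `Z` is nilpotent. -/
theorem hclR_exists_leftInv_nilpotent_shift {N r : ℕ} (F : Matrix (Fin N) (Fin r) ℂ)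
    (hF : F.rank = r) :
    ∃ Λ : Matrix (Fin r) (Fin N) ℂ, Λ * F = 1 ∧
      IsNilpotent (Λ * (Matrix.of fun i j : Fin N => if (i : ℕ) = (j : ℕ) + 1 then (1 : ℂ) else 0)
        * F) :=
  hclR_exists_leftInv_nilpotent_of_isNilpotent _ (hclR_isNilpotent_shift N) F hF

/-- Adapted left inverse, upper-shift side. -/
theorem hclR_exists_leftInv_nilpotent_shiftT {N r : ℕ} (E : Matrix (Fin N) (Fin r) ℂ)
    (hE : E.rank = r) :
    ∃ Λ : Matrix (Fin r) (Fin N) ℂ, Λ * E = 1 ∧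
      IsNilpotent (Λ * (Matrix.of fun i j : Fin N => if (i : ℕ) = (j : ℕ) + 1 then (1 : ℂ) else 0)ᵀ
        * E) :=
  hclR_exists_leftInv_nilpotent_of_isNilpotent _
    (Matrix.isNilpotent_transpose_iff.mpr (hclR_isNilpotent_shift N)) E hE

end Summit.MatrixMultiplication.MatrixMultiplication.Theorems
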